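import Mathlib
import HarnessLib
import Summits.Ventures.LatticeQCDFlow.Scoring.AllPairsAcceptanceVarianceSharpness
import Summits.Ventures.LatticeQCDFlow.Scoring.PairAcceptanceVarianceRigidity

/-!
# LatticeQCDFlow / Scoring — RIGIDITY of the ceiling-free acceptance-variance envelope on a GENERAL
# space: equality `Var[Û] = (2(1 − a²) + 4(n − 2)·a(1 − a))/(n(n − 1))` holds iff the flow is
# hit-or-miss almost everywhere, `p = q·𝟙_A/q(A)` a.e.

HONEST FRAMING: exact (Metropolis-corrected) sampling algorithms for lattice gauge theory;
figures of merit are autocorrelation/cost numbers at stated couplings and volumes; no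
continuum-physics claim.

Venture `LatticeQCDFlow` (cell pub-lqcd), sub-topic `Scoring`; FANOUT row 3 (`s0-u1-a`, S0-B
implementation A, GEN-11).  NEW WORK of the cell (elementary measure theory), the general-space form
of row 3's finite `Scoring/PairAcceptanceVarianceRigidity` (imported for the pointwise equality case
`min_sq_eq_mul_iff`), closing "uniqueness of the maximiser" listed as NOT CLAIMED in row 3's
`Scoring/AllPairsAcceptanceVarianceSharpness` (GEN-10, imported).  Setting of
`Scoring/AllPairsAcceptanceVariance`: a reference measure `μ` (s-finite) on any measurable space
`X`, a target density `p ≥ 0` (`∫ p dμ = 1`), a model density `q > 0` (law `q dμ` a probability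
measure), `n ≥ 2` independent model draws on an abstract probability space, `w = p/q`, the all-pairs
estimator `Û` of `a = acc(p, q)`, Hoeffding's `c₂ = ∫ min(w, w′)² d((q dμ)⊗(q dμ))` and
`c₁ = ∫ h² d(q dμ)`, `h(a) = ∫ min(w(a), w(b)) q(b) dμ(b)`.  NO definition is introduced; the
hit-or-miss property is spelled `∃ c, ∀ᵐ y ∂μ, 0 < p y → p y / q y = c` (all positive importance
ratios agree almost everywhere).

* §1 `one_sub_sqMoment_eq_integral_defect` — the DEFECT IDENTITY
  `1 − c₂ = ∫ (p ⊗ p − min(w, w′)²·(q ⊗ q)) d(μ ⊗ μ)` with a nonnegative integrand;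
* §2 **`hitOrMiss_ae_of_sqMoment_eq_one`** — `c₂ = 1 ⇒` hit-or-miss a.e. (the defect integrand
  vanishes `μ ⊗ μ`-a.e., hence (`Measure.ae_ae_of_ae_prod`) for a.e. `x`, for a.e. `y`,
  `w x = w y ∨ w x = 0 ∨ w y = 0`; a point `x₀` of the full-measure set with `p x₀ > 0` exists because
  `∫ p = 1`, and `c = w x₀`);  **`sqMoment_eq_one_of_hitOrMiss_ae`** — the converse (the two
  integrands agree `μ ⊗ μ`-a.e., by `quasiMeasurePreserving_fst/snd`); `sqMoment_eq_one_iff`;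
* §3 for a hit-or-miss pair: `condMean_ae_eq_of_hitOrMiss_ae` (`h = 𝟙_{p>0}` a.e.),
  **`meanAccept_eq_modelMass_of_hitOrMiss_ae`** (`acc = ∫_{p>0} q dμ`, the model mass of the
  target's support) and `condMeanSq_eq_meanAccept_of_hitOrMiss_ae` (`c₁ = a`);
* §4 **`variance_allPairs_eq_sharp_iff`** — for every `n ≥ 2`, EQUALITY in
  `variance_allPairs_le_sharp` iff hit-or-miss a.e.; **`variance_allPairs_lt_sharp`** — strict
  inequality for every other flow;
* §5 `hitOrMiss_ae_iff_eq_condModel` — hit-or-miss a.e. `↔ ∃ A α, MeasurableSet A ∧ 0 < α ∧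
  ∫_A q dμ = α ∧ p = q·𝟙_A/α a.e.` — exactly the hypotheses of GEN-10's
  `variance_allPairs_hitOrMiss`, so the maximisers found there are ALL the maximisers.

Reading (value-free): on any configuration space, the distribution-free acceptance error bar of the
all-pairs estimate is attained only by flows whose every proposal is either an exact draw from the
target or lands outside its support; every other flow is strictly inside the bar.
NOT CLAIMED: a quantitative deficit below the envelope; anything about the self-normalised monitor
or about chains; any number of ours.
-/

namespace Summit.Ventures.LatticeQCDFlow.Scoring.AllPairsVariance

open MeasureTheory ProbabilityTheory Finset Set

variable {Ω : Type*} [MeasurableSpace Ω] {P : Measure Ω} [IsProbabilityMeasure P]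
variable {X : Type*} [MeasurableSpace X] {μ : Measure X} [SFinite μ] {n : ℕ}

/-! ## §1 The defect identity -/

omit [MeasurableSpace X] [SFinite μ] in
/-- Pointwise: `min(w₁, w₂)²·(q₁q₂) ≤ w₁w₂·(q₁q₂) = p₁p₂` for `q > 0`, `p ≥ 0`. [ours] -/
theorem sq_pairMin_mul_le_mul {p q : X → ℝ} (hp0 : ∀ y, 0 ≤ p y) (hq0 : ∀ y, 0 < q y)
    (z : X × X) :
    min (p z.1 / q z.1) (p z.2 / q z.2) ^ 2 * (q z.1 * q z.2) ≤ p z.1 * p z.2 := by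
  calc min (p z.1 / q z.1) (p z.2 / q z.2) ^ 2 * (q z.1 * q z.2)
      ≤ (p z.1 / q z.1) * (p z.2 / q z.2) * (q z.1 * q z.2) :=
        mul_le_mul_of_nonneg_right (PairedDraws.sq_pairMin_le_mul hp0 hq0 z)
          (mul_nonneg (hq0 _).le (hq0 _).le)
    _ = p z.1 * p z.2 := by field_simp [(hq0 z.1).ne', (hq0 z.2).ne']

/-- **The defect identity**: `1 − c₂ = ∫ (p₁p₂ − min(w₁, w₂)²·q₁q₂) d(μ ⊗ μ)`, for a normalised
target `p ≥ 0` and a model `q > 0`. [ours] -/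
theorem one_sub_sqMoment_eq_integral_defect {p q : X → ℝ} (hp0 : ∀ y, 0 ≤ p y)
    (hpm : Measurable p) (hpi : Integrable p μ) (hp1 : ∫ y, p y ∂μ = 1) (hq0 : ∀ y, 0 < q y)
    (hqm : Measurable q) :
    1 - ∫ z, min (p z.1 / q z.1) (p z.2 / q z.2) ^ 2
        ∂(μ.withDensity fun y => ENNReal.ofReal (q y)).prod
          (μ.withDensity fun y => ENNReal.ofReal (q y))
      = ∫ z, (p z.1 * p z.2 - min (p z.1 / q z.1) (p z.2 / q z.2) ^ 2 * (q z.1 * q z.2))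
          ∂(μ.prod μ) := by
  rw [integral_prod_withDensity_eq (fun y => (hq0 y).le) hqm,
    integral_sub (hpi.mul_prod hpi) (integrable_sq_pairMin_mul hp0 hpm hpi hq0 hqm),
    integral_prod_mul (fun a => p a) (fun b => p b), hp1, mul_one]

/-! ## §2 `c₂ = 1` iff hit-or-miss almost everywhere -/

/-- **`c₂ = 1 ⇒` hit-or-miss a.e.**: if `∫ min(w, w′)² d((q dμ)⊗(q dμ)) = 1` then all positive
importance ratios agree almost everywhere: `∃ c, ∀ᵐ y ∂μ, 0 < p y → p y / q y = c`. [ours] -/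
theorem hitOrMiss_ae_of_sqMoment_eq_one {p q : X → ℝ} (hp0 : ∀ y, 0 ≤ p y) (hpm : Measurable p)
    (hpi : Integrable p μ) (hp1 : ∫ y, p y ∂μ = 1) (hq0 : ∀ y, 0 < q y) (hqm : Measurable q)
    (h : ∫ z, min (p z.1 / q z.1) (p z.2 / q z.2) ^ 2
        ∂(μ.withDensity fun y => ENNReal.ofReal (q y)).prod
          (μ.withDensity fun y => ENNReal.ofReal (q y)) = 1) :
    ∃ c : ℝ, ∀ᵐ y ∂μ, 0 < p y → p y / q y = c := by
  -- the defect integrand vanishes a.e.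
  have hD : ∫ z, (p z.1 * p z.2 - min (p z.1 / q z.1) (p z.2 / q z.2) ^ 2 * (q z.1 * q z.2))
      ∂(μ.prod μ) = 0 := by
    rw [← one_sub_sqMoment_eq_integral_defect hp0 hpm hpi hp1 hq0 hqm, h, sub_self]
  have hnn : 0 ≤ᵐ[μ.prod μ] fun z : X × X =>
      p z.1 * p z.2 - min (p z.1 / q z.1) (p z.2 / q z.2) ^ 2 * (q z.1 * q z.2) :=
    Filter.Eventually.of_forall fun z => sub_nonneg.mpr (sq_pairMin_mul_le_mul hp0 hq0 z)
  have hint : Integrable (fun z : X × X =>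
      p z.1 * p z.2 - min (p z.1 / q z.1) (p z.2 / q z.2) ^ 2 * (q z.1 * q z.2)) (μ.prod μ) :=
    (hpi.mul_prod hpi).sub (integrable_sq_pairMin_mul hp0 hpm hpi hq0 hqm)
  have hae : (fun z : X × X =>
      p z.1 * p z.2 - min (p z.1 / q z.1) (p z.2 / q z.2) ^ 2 * (q z.1 * q z.2)) =ᵐ[μ.prod μ] 0 :=
    (integral_eq_zero_iff_of_nonneg_ae hnn hint).mp hD
  -- hence for a.e. `x`, for a.e. `y`: `w x = w y ∨ w x = 0 ∨ w y = 0`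
  have hxy : ∀ᵐ x ∂μ, ∀ᵐ y ∂μ,
      p x / q x = p y / q y ∨ p x / q x = 0 ∨ p y / q y = 0 := by
    refine (Measure.ae_ae_of_ae_prod hae).mono fun x hx => hx.mono fun y hy => ?_
    have hw1 : 0 ≤ p x / q x := div_nonneg (hp0 x) (hq0 x).le
    have hw2 : 0 ≤ p y / q y := div_nonneg (hp0 y) (hq0 y).le
    refine (Scoring.min_sq_eq_mul_iff hw1 hw2).mp ?_
    have hqq : q x * q y ≠ 0 := (mul_pos (hq0 x) (hq0 y)).ne'
    have e : p x * p y = (p x / q x) * (p y / q y) * (q x * q y) := by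
      rw [div_mul_div_comm, div_mul_cancel₀ _ hqq]
    have hz : p x * p y - min (p x / q x) (p y / q y) ^ 2 * (q x * q y) = 0 := hy
    rw [e, ← sub_mul, mul_eq_zero] at hz
    rcases hz with hz | hz
    · linarith
    · exact absurd hz hqq
  -- a point of the full-measure set carrying positive target mass
  obtain ⟨x₀, hx₀p, hx₀⟩ : ∃ x₀, 0 < p x₀ ∧ ∀ᵐ y ∂μ,
      p x₀ / q x₀ = p y / q y ∨ p x₀ / q x₀ = 0 ∨ p y / q y = 0 := by
    by_contra hne
    have hp0ae : p =ᵐ[μ] 0 := by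
      refine hxy.mono fun x hx => ?_
      have : ¬ 0 < p x := fun hpx => hne ⟨x, hpx, hx⟩
      exact le_antisymm (not_lt.mp this) (hp0 x)
    have : ∫ y, p y ∂μ = 0 := by rw [integral_congr_ae hp0ae]; simp
    rw [hp1] at this
    exact one_ne_zero this
  refine ⟨p x₀ / q x₀, hx₀.mono fun y hy hpy => ?_⟩
  have hc : 0 < p x₀ / q x₀ := div_pos hx₀p (hq0 x₀)
  have hwy : 0 < p y / q y := div_pos hpy (hq0 y)
  rcases hy with e | e | e
  · exact e.symm
  · exact absurd e hc.ne'
  · exact absurd e hwy.ne'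

/-- **Hit-or-miss a.e. `⇒ c₂ = 1`**: if all positive importance ratios agree a.e. then
`min(w₁, w₂)²·q₁q₂ = p₁p₂` for `μ ⊗ μ`-a.e. pair, so `c₂ = ∫∫ p ⊗ p = 1`. [ours] -/
theorem sqMoment_eq_one_of_hitOrMiss_ae {p q : X → ℝ} (hp0 : ∀ y, 0 ≤ p y)
    (hp1 : ∫ y, p y ∂μ = 1) (hq0 : ∀ y, 0 < q y) (hqm : Measurable q)
    (h : ∃ c : ℝ, ∀ᵐ y ∂μ, 0 < p y → p y / q y = c) :
    ∫ z, min (p z.1 / q z.1) (p z.2 / q z.2) ^ 2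
        ∂(μ.withDensity fun y => ENNReal.ofReal (q y)).prod
          (μ.withDensity fun y => ENNReal.ofReal (q y)) = 1 := by
  obtain ⟨c, hc⟩ := h
  rw [integral_prod_withDensity_eq (fun y => (hq0 y).le) hqm]
  have h12 : ∀ᵐ z ∂(μ.prod μ), (0 < p z.1 → p z.1 / q z.1 = c) ∧ (0 < p z.2 → p z.2 / q z.2 = c) :=
    ((Measure.quasiMeasurePreserving_fst (μ := μ) (ν := μ)).ae hc).and
      ((Measure.quasiMeasurePreserving_snd (μ := μ) (ν := μ)).ae hc)
  have hae : (fun z : X × X => min (p z.1 / q z.1) (p z.2 / q z.2) ^ 2 * (q z.1 * q z.2))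
      =ᵐ[μ.prod μ] fun z => p z.1 * p z.2 := by
    refine h12.mono fun z hz => ?_
    obtain ⟨h1, h2⟩ := hz
    have hw1 : 0 ≤ p z.1 / q z.1 := div_nonneg (hp0 _) (hq0 _).le
    have hw2 : 0 ≤ p z.2 / q z.2 := div_nonneg (hp0 _) (hq0 _).le
    have key : min (p z.1 / q z.1) (p z.2 / q z.2) ^ 2 = (p z.1 / q z.1) * (p z.2 / q z.2) := by
      refine (Scoring.min_sq_eq_mul_iff hw1 hw2).mpr ?_
      by_cases hz1 : 0 < p z.1
      · by_cases hz2 : 0 < p z.2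
        · exact Or.inl (by rw [h1 hz1, h2 hz2])
        · have : p z.2 = 0 := le_antisymm (not_lt.mp hz2) (hp0 _)
          exact Or.inr (Or.inr (by rw [this, zero_div]))
      · have : p z.1 = 0 := le_antisymm (not_lt.mp hz1) (hp0 _)
        exact Or.inr (Or.inl (by rw [this, zero_div]))
    show min (p z.1 / q z.1) (p z.2 / q z.2) ^ 2 * (q z.1 * q z.2) = p z.1 * p z.2
    rw [key]
    field_simp [(hq0 z.1).ne', (hq0 z.2).ne']
  rw [integral_congr_ae hae, integral_prod_mul (fun a => p a) (fun b => p b), hp1, mul_one]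

/-- **`c₂ = 1 ↔` hit-or-miss a.e.** [ours] -/
theorem sqMoment_eq_one_iff {p q : X → ℝ} (hp0 : ∀ y, 0 ≤ p y) (hpm : Measurable p)
    (hpi : Integrable p μ) (hp1 : ∫ y, p y ∂μ = 1) (hq0 : ∀ y, 0 < q y) (hqm : Measurable q) :
    ∫ z, min (p z.1 / q z.1) (p z.2 / q z.2) ^ 2
        ∂(μ.withDensity fun y => ENNReal.ofReal (q y)).prod
          (μ.withDensity fun y => ENNReal.ofReal (q y)) = 1 ↔
      ∃ c : ℝ, ∀ᵐ y ∂μ, 0 < p y → p y / q y = c :=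
  ⟨hitOrMiss_ae_of_sqMoment_eq_one hp0 hpm hpi hp1 hq0 hqm,
    sqMoment_eq_one_of_hitOrMiss_ae hp0 hp1 hq0 hqm⟩


/-! ## §3 What a hit-or-miss pair looks like: `h = 𝟙_{p>0}` a.e., `acc = ∫_{p>0} q dμ`, `c₁ = a` -/

omit [SFinite μ] in
/-- For a hit-or-miss pair the Hoeffding projection is an indicator almost everywhere:
`h(a) = ∫ min(w(a), w(b)) d(q dμ)(b) = 𝟙(0 < p a)` for `μ`-a.e. `a` (where `p a > 0` one has
`w a = c` and `min(c, w b) = w b` for a.e. `b`, and `∫ w d(q dμ) = ∫ p dμ = 1`). [ours] -/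
theorem condMean_ae_eq_of_hitOrMiss_ae {p q : X → ℝ} (hp0 : ∀ y, 0 ≤ p y)
    (hpi : Integrable p μ) (hp1 : ∫ y, p y ∂μ = 1) (hq0 : ∀ y, 0 < q y) (hqm : Measurable q)
    (h : ∃ c : ℝ, ∀ᵐ y ∂μ, 0 < p y → p y / q y = c) :
    (fun a => ∫ b, min (p a / q a) (p b / q b) ∂(μ.withDensity fun y => ENNReal.ofReal (q y)))
      =ᵐ[μ] fun a => if 0 < p a then 1 else 0 := by
  obtain ⟨c, hc⟩ := h
  have hcν : ∀ᵐ b ∂(μ.withDensity fun y => ENNReal.ofReal (q y)), 0 < p b → p b / q b = c :=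
    (withDensity_absolutelyContinuous μ _).ae_le hc
  obtain ⟨-, hw1⟩ := integral_weight_withDensity_eq (μ := μ) hpi hq0 hqm
  refine hc.mono fun a ha => ?_
  have hwa : 0 ≤ p a / q a := div_nonneg (hp0 a) (hq0 a).le
  show ∫ b, min (p a / q a) (p b / q b) ∂(μ.withDensity fun y => ENNReal.ofReal (q y))
    = if 0 < p a then 1 else 0
  split_ifs with hpa
  · rw [← hp1, ← hw1]
    refine integral_congr_ae (hcν.mono fun b hb => ?_)
    show min (p a / q a) (p b / q b) = p b / q b
    by_cases hpb : 0 < p b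
    · rw [ha hpa, hb hpb, min_self]
    · have : p b = 0 := le_antisymm (not_lt.mp hpb) (hp0 b)
      rw [this, zero_div]
      exact min_eq_right hwa
  · have hpa0 : p a = 0 := le_antisymm (not_lt.mp hpa) (hp0 a)
    have e : ∀ b, min (p a / q a) (p b / q b) = 0 := fun b => by
      rw [hpa0, zero_div]
      exact min_eq_left (div_nonneg (hp0 b) (hq0 b).le)
    simp_rw [e]
    exact integral_zero _ _

/-- **`acc = ∫_{p>0} q dμ`**: the equilibrium acceptance of a hit-or-miss flow is the model mass of
the target's support. [ours] -/
theorem meanAccept_eq_modelMass_of_hitOrMiss_ae {p q : X → ℝ} (hp0 : ∀ y, 0 ≤ p y)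
    (hpm : Measurable p) (hpi : Integrable p μ) (hp1 : ∫ y, p y ∂μ = 1) (hq0 : ∀ y, 0 < q y)
    (hqm : Measurable q) (hqi : Integrable q μ)
    [IsProbabilityMeasure (μ.withDensity fun y => ENNReal.ofReal (q y))]
    (h : ∃ c : ℝ, ∀ᵐ y ∂μ, 0 < p y → p y / q y = c) :
    ∫ a, ∫ b, min (p a * q b) (p b * q a) ∂μ ∂μ = ∫ y in {y | 0 < p y}, q y ∂μ := by
  have hF2 := memLp_pairMin_two (μ := μ) hp0 hpm hpi hq0 hqm
  have hA : MeasurableSet {y | 0 < p y} := measurableSet_lt measurable_const hpm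
  have hind : (fun a => ∫ b, min (p a / q a) (p b / q b)
      ∂(μ.withDensity fun y => ENNReal.ofReal (q y)))
      =ᵐ[μ.withDensity fun y => ENNReal.ofReal (q y)]
        fun a => {y | 0 < p y}.indicator (fun _ => (1 : ℝ)) a := by
    refine ((withDensity_absolutelyContinuous μ _).ae_eq
      (condMean_ae_eq_of_hitOrMiss_ae hp0 hpi hp1 hq0 hqm h)).mono fun a ha => ?_
    beta_reduce at ha ⊢
    rw [ha]
    by_cases hpa : 0 < p a
    · rw [if_pos hpa, indicator_of_mem (show a ∈ {y | 0 < p y} from hpa)]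
    · rw [if_neg hpa, indicator_of_notMem (show a ∉ {y | 0 < p y} from hpa)]
  rw [← integral_pairMin_withDensity_eq_meanAccept hp0 hpm hpi hq0 hqm hqi,
    ← integral_condMean_eq (F := fun a b => min (p a / q a) (p b / q b)) hF2,
    integral_congr_ae hind, integral_indicator_const _ hA, smul_eq_mul, mul_one, measureReal_def,
    withDensity_apply _ hA, ← ofReal_integral_eq_lintegral_ofReal hqi.integrableOn
      (Filter.Eventually.of_forall fun y => (hq0 y).le),
    ENNReal.toReal_ofReal (setIntegral_nonneg hA fun y _ => (hq0 y).le)]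

/-- **`c₁ = a`** for a hit-or-miss pair: `h ∈ {0, 1}` a.e., so `∫ h² d(q dμ) = ∫ h d(q dμ) = acc`.
[ours] -/
theorem condMeanSq_eq_meanAccept_of_hitOrMiss_ae {p q : X → ℝ} (hp0 : ∀ y, 0 ≤ p y)
    (hpm : Measurable p) (hpi : Integrable p μ) (hp1 : ∫ y, p y ∂μ = 1) (hq0 : ∀ y, 0 < q y)
    (hqm : Measurable q) (hqi : Integrable q μ)
    [IsProbabilityMeasure (μ.withDensity fun y => ENNReal.ofReal (q y))]
    (h : ∃ c : ℝ, ∀ᵐ y ∂μ, 0 < p y → p y / q y = c) :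
    ∫ a, (∫ b, min (p a / q a) (p b / q b) ∂(μ.withDensity fun y => ENNReal.ofReal (q y))) ^ 2
        ∂(μ.withDensity fun y => ENNReal.ofReal (q y))
      = ∫ a, ∫ b, min (p a * q b) (p b * q a) ∂μ ∂μ := by
  have hF2 := memLp_pairMin_two (μ := μ) hp0 hpm hpi hq0 hqm
  have hsq : (fun a => (∫ b, min (p a / q a) (p b / q b)
      ∂(μ.withDensity fun y => ENNReal.ofReal (q y))) ^ 2)
      =ᵐ[μ.withDensity fun y => ENNReal.ofReal (q y)]
        fun a => ∫ b, min (p a / q a) (p b / q b) ∂(μ.withDensity fun y => ENNReal.ofReal (q y)) := by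
    refine ((withDensity_absolutelyContinuous μ _).ae_eq
      (condMean_ae_eq_of_hitOrMiss_ae hp0 hpi hp1 hq0 hqm h)).mono fun a ha => ?_
    beta_reduce at ha ⊢
    rw [ha]
    split_ifs <;> norm_num
  rw [integral_congr_ae hsq, integral_condMean_eq (F := fun a b => min (p a / q a) (p b / q b)) hF2,
    integral_pairMin_withDensity_eq_meanAccept hp0 hpm hpi hq0 hqm hqi]

/-! ## §4 The rigidity theorem -/

/-- **RIGIDITY OF THE CEILING-FREE ENVELOPE (general space).**  For a normalised target `p ≥ 0`, a
model `q > 0` with law `q dμ` and `n ≥ 2` independent model draws: the variance of the all-pairs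
acceptance estimator EQUALS the sharp envelope,
`Var[Û] = (2(1 − a²) + 4(n − 2)·a(1 − a))/(n(n − 1))` with `a = acc(p, q)`, IF AND ONLY IF the pair
is hit-or-miss almost everywhere (`∃ c, ∀ᵐ y ∂μ, 0 < p y → p y / q y = c`). [ours] -/
theorem variance_allPairs_eq_sharp_iff {x : Fin n → Ω → X} (hxm : ∀ i, Measurable (x i))
    (hind : iIndepFun x P) {p q : X → ℝ} (hp0 : ∀ y, 0 ≤ p y) (hpm : Measurable p)
    (hpi : Integrable p μ) (hp1 : ∫ y, p y ∂μ = 1) (hq0 : ∀ y, 0 < q y) (hqm : Measurable q)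
    (hqi : Integrable q μ)
    (hlaw : ∀ i, Measure.map (x i) P = μ.withDensity fun y => ENNReal.ofReal (q y))
    (hn : 2 ≤ n) :
    Var[fun ω => (∑ z ∈ (univ : Finset (Fin n)).offDiag,
        min (p (x z.1 ω) / q (x z.1 ω)) (p (x z.2 ω) / q (x z.2 ω))) / (n * (n - 1) : ℝ); P]
      = (2 * (1 - (∫ a, ∫ b, min (p a * q b) (p b * q a) ∂μ ∂μ) ^ 2)
          + 4 * (n - 2) * ((∫ a, ∫ b, min (p a * q b) (p b * q a) ∂μ ∂μ)
            * (1 - ∫ a, ∫ b, min (p a * q b) (p b * q a) ∂μ ∂μ))) / (n * (n - 1)) ↔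
    ∃ c : ℝ, ∀ᵐ y ∂μ, 0 < p y → p y / q y = c := by
  haveI := isProbabilityMeasure_of_map_eq_iid (hxm ⟨0, by omega⟩) (hlaw ⟨0, by omega⟩)
  rw [variance_allPairs_eq hxm hind hp0 hpm hpi hq0 hqm hqi hlaw hn]
  have h2 : (2 : ℝ) ≤ n := by exact_mod_cast hn
  have hNpos : (0 : ℝ) < n * (n - 1) := by
    have : (0 : ℝ) < n := by linarith
    have : (0 : ℝ) < n - 1 := by linarith
    positivity
  constructor
  · intro heq
    have hm2 := integral_sq_pairMin_withDensity_le_one (μ := μ) hp0 hpm hpi hp1 hq0 hqm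
    have hm1 := integral_condMean_sq_pairMin_le_meanAccept (μ := μ) hp0 hpm hpi hp1 hq0 hqm hqi
    have h4 : (0 : ℝ) ≤ 4 * (n - 2) := by linarith
    rw [div_left_inj' hNpos.ne'] at heq
    have hprod := mul_le_mul_of_nonneg_left hm1 h4
    have hm2eq : ∫ z, min (p z.1 / q z.1) (p z.2 / q z.2) ^ 2
        ∂(μ.withDensity fun y => ENNReal.ofReal (q y)).prod
          (μ.withDensity fun y => ENNReal.ofReal (q y)) = 1 := by
      nlinarith
    exact hitOrMiss_ae_of_sqMoment_eq_one hp0 hpm hpi hp1 hq0 hqm hm2eq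
  · intro h
    rw [sqMoment_eq_one_of_hitOrMiss_ae hp0 hp1 hq0 hqm h,
      condMeanSq_eq_meanAccept_of_hitOrMiss_ae hp0 hpm hpi hp1 hq0 hqm hqi h]
    ring

/-- **STRICT inequality off the hit-or-miss family** (general space): if the positive importance
ratios do NOT agree almost everywhere, `Var[Û]` is STRICTLY below the envelope, at every `n ≥ 2`.
[ours] -/
theorem variance_allPairs_lt_sharp {x : Fin n → Ω → X} (hxm : ∀ i, Measurable (x i))
    (hind : iIndepFun x P) {p q : X → ℝ} (hp0 : ∀ y, 0 ≤ p y) (hpm : Measurable p)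
    (hpi : Integrable p μ) (hp1 : ∫ y, p y ∂μ = 1) (hq0 : ∀ y, 0 < q y) (hqm : Measurable q)
    (hqi : Integrable q μ)
    (hlaw : ∀ i, Measure.map (x i) P = μ.withDensity fun y => ENNReal.ofReal (q y))
    (hn : 2 ≤ n) (hne : ¬ ∃ c : ℝ, ∀ᵐ y ∂μ, 0 < p y → p y / q y = c) :
    Var[fun ω => (∑ z ∈ (univ : Finset (Fin n)).offDiag,
        min (p (x z.1 ω) / q (x z.1 ω)) (p (x z.2 ω) / q (x z.2 ω))) / (n * (n - 1) : ℝ); P]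
      < (2 * (1 - (∫ a, ∫ b, min (p a * q b) (p b * q a) ∂μ ∂μ) ^ 2)
          + 4 * (n - 2) * ((∫ a, ∫ b, min (p a * q b) (p b * q a) ∂μ ∂μ)
            * (1 - ∫ a, ∫ b, min (p a * q b) (p b * q a) ∂μ ∂μ))) / (n * (n - 1)) :=
  lt_of_le_of_ne (variance_allPairs_le_sharp hxm hind hp0 hpm hpi hp1 hq0 hqm hqi hlaw hn)
    fun heq => hne ((variance_allPairs_eq_sharp_iff hxm hind hp0 hpm hpi hp1 hq0 hqm hqi hlaw hn).mp
      heq)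

/-! ## §5 Hit-or-miss a.e. `↔` the target is the model conditioned on a region -/

omit [SFinite μ] in
/-- **Hit-or-miss a.e. `↔ p = q·𝟙_A/α` a.e.** with `A` measurable, `α = ∫_A q dμ > 0` — exactly the
hypotheses under which row 3's `variance_allPairs_hitOrMiss` (GEN-10) computes the variance as the
envelope; so the maximisers exhibited there are ALL the maximisers.  (`→`: `A = {p > 0}`,
`α = ∫_A q dμ`, and `c·α = ∫ p dμ = 1`.) [ours] -/
theorem hitOrMiss_ae_iff_eq_condModel {p q : X → ℝ} (hp0 : ∀ y, 0 ≤ p y) (hpm : Measurable p)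
    (hp1 : ∫ y, p y ∂μ = 1) (hq0 : ∀ y, 0 < q y) :
    (∃ c : ℝ, ∀ᵐ y ∂μ, 0 < p y → p y / q y = c) ↔
      ∃ (A : Set X) (α : ℝ), MeasurableSet A ∧ 0 < α ∧ ∫ y in A, q y ∂μ = α ∧
        p =ᵐ[μ] fun y => A.indicator q y / α := by
  constructor
  · rintro ⟨c, hc⟩
    have hA : MeasurableSet {y | 0 < p y} := measurableSet_lt measurable_const hpm
    have hpc : p =ᵐ[μ] fun y => {y | 0 < p y}.indicator (fun y => c * q y) y := by
      refine hc.mono fun y hy => ?_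
      show p y = {y | 0 < p y}.indicator (fun y => c * q y) y
      by_cases hpy : 0 < p y
      · rw [indicator_of_mem (show y ∈ {y | 0 < p y} from hpy)]
        have e := hy hpy
        rw [div_eq_iff (hq0 y).ne'] at e
        exact e
      · rw [indicator_of_notMem (show y ∉ {y | 0 < p y} from hpy)]
        exact le_antisymm (not_lt.mp hpy) (hp0 y)
    have hcα : c * ∫ y in {y | 0 < p y}, q y ∂μ = 1 := by
      rw [← hp1, integral_congr_ae hpc, integral_indicator hA, integral_const_mul]
    have hαpos : 0 < ∫ y in {y | 0 < p y}, q y ∂μ := by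
      rcases (setIntegral_nonneg hA fun y _ => (hq0 y).le).eq_or_lt with h0 | h0
      · rw [← h0, mul_zero] at hcα
        exact absurd hcα zero_ne_one
      · exact h0
    refine ⟨{y | 0 < p y}, ∫ y in {y | 0 < p y}, q y ∂μ, hA, hαpos, rfl, hpc.mono fun y hy => ?_⟩
    rw [hy]
    show {y | 0 < p y}.indicator (fun y => c * q y) y
      = {y | 0 < p y}.indicator q y / ∫ y in {y | 0 < p y}, q y ∂μ
    by_cases hyA : y ∈ {y | 0 < p y}
    · rw [indicator_of_mem hyA, indicator_of_mem hyA, eq_div_iff hαpos.ne', mul_assoc, mul_comm (q y),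
        ← mul_assoc, hcα, one_mul]
    · rw [indicator_of_notMem hyA, indicator_of_notMem hyA, zero_div]
  · rintro ⟨A, α, -, hα, -, hpA⟩
    refine ⟨α⁻¹, hpA.mono fun y hy hpy => ?_⟩
    rw [hy] at hpy ⊢
    beta_reduce at hpy ⊢
    by_cases hyA : y ∈ A
    · rw [indicator_of_mem hyA]
      field_simp [(hq0 y).ne', hα.ne']
    · rw [indicator_of_notMem hyA, zero_div] at hpy
      exact absurd hpy (lt_irrefl 0)

end Summit.Ventures.LatticeQCDFlow.Scoring.AllPairsVariance
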